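import Literature.Analysis.Complex.JensenPolynomialHyperbolicity
import Literature.NumberTheory.LFunctions.RHConditionalFacts
import Literature.NumberTheory.LFunctions.XiMultiplePositivityProofs
import HarnessLib

/-!
# Pólya's criterion `RH ↔ all Jensen polynomials of Ξ are hyperbolic` — proved

Trunk T-ANT (`Literature/NumberTheory/LFunctions`), namespace `Literature.RH`; companion ("Proofs") file
of `RHConditionalFacts.lean` for the named fact

  `Literature.RH.polya_jensen : RiemannHypothesis ↔ JensenPolyaCriterion`

(**rh.S39**; G. Pólya, *Über die algebraisch-funktionentheoretischen Untersuchungen von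
J. L. W. V. Jensen*, Kgl. Danske Vid. Sel. Math.-Fys. Medd. 7 (1927) 3–33 [Polya1927], as stated in
Griffin–Ono–Rolen–Zagier, PNAS 116 (2019), §1 [GORZPNAS2019]: "Pólya proved that the RH is
equivalent to the hyperbolicity of the polynomials `J^{d,n}_γ(X)` for all nonnegative integers `d`
and `n`", where `(−1 + 4z²) Λ(½ + z) = Σ γ(n) z^{2n}/n!` and
`J^{d,n}_γ(X) = Σ_{j ≤ d} (d choose j) γ(n + j) X^j`). It is DISCHARGED here:
`Literature.RH.polya_jensen_holds : polya_jensen`, sorry-free, axioms `propext`, `Classical.choice`,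
`Quot.sound` only.

Note on the item that requested this work: `Literature.NumberTheory.LFunctions.JensenPolyaCriterion` (`Equivalents.lean`) is
the *criterion itself* (`∀ d n, (jensenPoly xiTaylorCoeff d n).Splits`), a `def … : Prop` which by
the present theorem is equivalent to the Riemann hypothesis; it is not a theorem of [Polya1927]
and cannot be discharged. The theorem printed in the source is the equivalence, which the tree
already vendors as `Literature.NumberTheory.LFunctions.polya_jensen`; that is what is proved.

## The proof

Let `G = Literature.RH.xiSq` be the entire function with `G(w²) = ξ(½ + w)` (`ZetaLogDerivSeries.lean`:
power series `Σ aₙ zⁿ`, `aₙ = γ(n)/(8·n!)`, infinite radius, order `≤ 7/8`, `G(0) = ξ(½) ≠ 0`,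
`G(z̄) = conj G(z)`). Then `γ(k) = 8 G⁽ᵏ⁾(0)` (`xiTaylorCoeff_eq_re_iteratedDeriv_xiSq`), so the
Jensen polynomials of `γ` are `8 ×` those of the Taylor sequence of `G`, and the zeros of `G` are
the numbers `(ρ - ½)²`, `ρ` a nontrivial zero of `ζ` (`riemannXi_eq_zero_iff_holds`).

* `⇒` (`jensenPolyaCriterion_of_riemannHypothesis`): under RH every zero of `G` is real
  (`im_eq_zero_of_xiSq_eq_zero`), so `G` is an entire function of order `< 1` with real Taylor
  coefficients, `G(0) ≠ 0` and real zeros; by Hadamard's factorisation in genus `0`, the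
  Hermite–Poulain theorem and Hurwitz's theorem
  (`Literature.Analysis.Complex.PolyaSchur.splits_jensenPoly_taylor_of_zeros_real`, the genus-`0` Laguerre–Pólya /
  Pólya–Schur theorem, Craven–Csordas 1989 §1 (i)) all `J^{d,n}` are hyperbolic.
* `⇐` (`riemannHypothesis_of_jensenPolyaCriterion`): `J^{d,0}_γ(w/d) → 8 G(w)` locally uniformly
  (Craven–Csordas 1989, Lemma 2.2; `Literature.Analysis.Complex.PolyaSchur.tendstoLocallyUniformly_jensenPoly_scaled`),
  the `J^{d,0}_γ` are hyperbolic and `≠ 0`, so by Hurwitz every zero of `G` is real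
  (`im_eq_zero_of_xiSq_eq_zero_of_jensenPolyaCriterion`). For a nontrivial zero `ρ` of `ζ` this
  says `Im (ρ - ½)² = 0`, i.e. `Re ρ = ½` or `Im ρ = 0`, and the latter is excluded because `ζ`
  has no zeros on the real segment `(0, 1)` (`riemannZeta_ne_zero_of_im_eq_zero_of_pos_of_lt_one`,
  Titchmarsh §2.12). Only the shift `n = 0` of the criterion is used in this direction.
* By-products: `riemannHypothesis_iff_forall_xiSq_eq_zero_im_eq_zero` (RH ↔ all zeros of `G` are
  real — sharpening the tree's `xiSq_zeros_iff_riemannHypothesis`, which asks for real AND `≤ 0`),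
  `xiTaylorCoeff_eq_re_iteratedDeriv_xiSq` (`γ(k) = 8 G⁽ᵏ⁾(0)`).
* Reused from `XiMultiplePositivityProofs.lean` (Katkova's criterion, same `G = ξ₁`):
  `iteratedDeriv_xiSq_zero`, `isEntireOfOrderLtOne_xiSq`, `xiSq_zeros_iff_riemannHypothesis`.

## References

* [Polya1927] G. Pólya, Kgl. Danske Vid. Sel. Math.-Fys. Medd. 7 (1927) 3–33.
* [GORZPNAS2019] M. Griffin, K. Ono, L. Rolen, D. Zagier, PNAS 116 (2019) 11103–11110, §1, eq. (1).
* [CravenCsordas1989] T. Craven, G. Csordas, Pacific J. Math. 136 (1989) 241–260, §1 (i), Lemma 2.2.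
* [Titchmarsh1986] E. C. Titchmarsh, *The theory of the Riemann zeta-function*, 2nd ed., §2.12.
-/

noncomputable section

open Polynomial Complex Filter Topology Set
open scoped ComplexConjugate Nat

namespace Literature.NumberTheory.LFunctions

open Literature.Analysis.Complex.PolyaSchur

/-- The Taylor series of `G` at `0` converges on all of `ℂ`: `G(z) = Σ aₙ zⁿ` (every `z` is a
square). [folklore] -/
theorem hasSum_xiSqCoeff_mul_pow (z : ℂ) : HasSum (fun n : ℕ => xiSqCoeff n * z ^ n) (xiSq z) := by
  have hw : (z ^ (2⁻¹ : ℂ)) ^ 2 = z := by exact_mod_cast Complex.cpow_nat_inv_pow z two_ne_zero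
  have h := hasSum_xiSqCoeff (z ^ (2⁻¹ : ℂ))
  rw [hw, ← xiSq_eq] at h
  exact h

/-- **The GORZ coefficients are the Taylor coefficients of `8 G`**: `γ(k) = 8 · Re G⁽ᵏ⁾(0)`
(and `G⁽ᵏ⁾(0)` is real). [cite: GORZPNAS2019, eq. (1)] -/
theorem xiTaylorCoeff_eq_re_iteratedDeriv_xiSq (k : ℕ) :
    xiTaylorCoeff k = 8 * (iteratedDeriv k xiSq 0).re := by
  have hk : (k ! : ℂ) ≠ 0 := by exact_mod_cast Nat.factorial_ne_zero k
  have h : iteratedDeriv k xiSq 0 = ((xiTaylorCoeff k / 8 : ℝ) : ℂ) := by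
    rw [iteratedDeriv_xiSq_zero, xiSqCoeff]
    push_cast
    field_simp
  rw [h, Complex.ofReal_re]
  ring

/-- `G(0) = ξ(½)` is real. [folklore] -/
theorem xiSq_zero_im : (xiSq 0).im = 0 :=
  Complex.conj_eq_iff_im.1 conj_xiSq_zero

/-- **RH ⇒ the zeros of `G` are real** (indeed real and `≤ 0`: the tree's
`xiSq_zeros_iff_riemannHypothesis`, XiMultiplePositivityProofs.lean, Pólya's half of Katkova's
criterion). [cite: Titchmarsh1986, §2.12] -/
theorem im_eq_zero_of_xiSq_eq_zero (hRH : RiemannHypothesis) {z : ℂ} (hz : xiSq z = 0) :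
    z.im = 0 :=
  ((xiSq_zeros_iff_riemannHypothesis.2 hRH) z hz).1

/-- **Real zeros of `G` ⇒ RH**: a nontrivial zero `s` of `ζ` is a zero of `ξ(s) = G((s - ½)²)`, so
`(s - ½)² ∈ ℝ`, i.e. `Re s = ½` or `Im s = 0`; the latter is impossible since `ζ` has no zeros on
the real segment `(0, 1)` (Titchmarsh §2.12, `riemannZeta_ne_zero_of_im_eq_zero_of_pos_of_lt_one`).
[cite: Titchmarsh1986, §2.12] -/
theorem riemannHypothesis_of_forall_xiSq_eq_zero_im_eq_zero (h : ∀ z : ℂ, xiSq z = 0 → z.im = 0) :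
    RiemannHypothesis := by
  intro s hζ htriv hone
  have hξ : riemannXi s = 0 := riemannXi_eq_zero_of_nontrivial hζ htriv hone
  obtain ⟨-, h0, h1⟩ := (riemannXi_eq_zero_iff_holds s).1 hξ
  rw [riemannXi_eq_xiSq] at hξ
  have him := h _ hξ
  have hmul : (s.re - 1 / 2) * s.im = 0 := by
    simp only [sq, Complex.mul_im, Complex.sub_re, Complex.div_ofNat_re, Complex.one_re,
      Complex.sub_im, Complex.div_ofNat_im, Complex.one_im] at him
    nlinarith [him]
  rcases mul_eq_zero.1 hmul with hre | him0
  · linarith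
  · exact absurd hζ (riemannZeta_ne_zero_of_im_eq_zero_of_pos_of_lt_one him0 h0 h1)

/-- **RH ↔ every zero of `G` (i.e. of `Ξ(√z)`) is real** (Titchmarsh §2.12 / §10.1: RH says all
zeros of `Ξ` are real, and `Ξ(u) = G(-u²)`). [cite: Titchmarsh1986, §2.12] -/
theorem riemannHypothesis_iff_forall_xiSq_eq_zero_im_eq_zero :
    RiemannHypothesis ↔ ∀ z : ℂ, xiSq z = 0 → z.im = 0 :=
  ⟨fun h _ hz => im_eq_zero_of_xiSq_eq_zero h hz,
    riemannHypothesis_of_forall_xiSq_eq_zero_im_eq_zero⟩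

/-- **RH ⇒ the Jensen–Pólya criterion** (the "easy" half of Pólya 1927): under RH, `G` is an
entire function of order `< 1` with real Taylor coefficients and only real zeros, so by
Hadamard + Hermite–Poulain + Hurwitz (`Literature.Analysis.Complex.PolyaSchur.splits_jensenPoly_taylor_of_zeros_real`)
all Jensen polynomials of `(G⁽ᵏ⁾(0))ₖ = (γ(k)/8)ₖ` are hyperbolic. [cite: GORZPNAS2019, §1] -/
theorem jensenPolyaCriterion_of_riemannHypothesis (hRH : RiemannHypothesis) :
    JensenPolyaCriterion := by
  intro d n
  have h := splits_jensenPoly_taylor_of_zeros_real isEntireOfOrderLtOne_xiSq xiSq_zero_im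
    xiSq_zero_ne (fun z hz => im_eq_zero_of_xiSq_eq_zero hRH hz) d n
  have heq : jensenPoly xiTaylorCoeff d n =
      C 8 * jensenPoly (fun k => (iteratedDeriv k xiSq 0).re) d n := by
    rw [← jensenPoly_const_mul]
    congr 1
    funext k
    exact xiTaylorCoeff_eq_re_iteratedDeriv_xiSq k
  rw [heq]
  exact h.C_mul 8

/-- The majorant series `Σ |γ(j)|/j! Rʲ` converges for every `R ≥ 0` (`G` is entire). [folklore] -/
theorem summable_abs_xiTaylorCoeff_div_factorial_mul_pow (R : ℝ) (hR : 0 ≤ R) :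
    Summable fun j : ℕ => |xiTaylorCoeff j| / (j ! : ℝ) * R ^ j := by
  have h := (FormalMultilinearSeries.ofScalars ℂ xiSqCoeff).summable_norm_mul_pow
    (r := R.toNNReal) (by rw [xiSq_radius_eq_top]; exact ENNReal.coe_lt_top)
  simp only [FormalMultilinearSeries.ofScalars_norm, Real.coe_toNNReal _ hR] at h
  refine (h.mul_left 8).congr fun j => ?_
  have hj : (0 : ℝ) < j ! := by exact_mod_cast Nat.factorial_pos j
  rw [xiSqCoeff, norm_div, Complex.norm_real, Real.norm_eq_abs, norm_mul, Complex.norm_natCast,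
    Complex.norm_ofNat]
  field_simp

/-- `8 G(w) = Σⱼ γ(j) wʲ/j!`. [cite: GORZPNAS2019, eq. (1)] -/
theorem hasSum_xiTaylorCoeff_div_factorial_mul_pow (w : ℂ) :
    HasSum (fun j : ℕ => (xiTaylorCoeff j : ℂ) / (j ! : ℂ) * w ^ j) (8 * xiSq w) := by
  refine ((hasSum_xiSqCoeff_mul_pow w).mul_left 8).congr_fun fun j => ?_
  have hj : (j ! : ℂ) ≠ 0 := by exact_mod_cast Nat.factorial_ne_zero j
  rw [xiSqCoeff]
  field_simp

/-- **The Jensen–Pólya criterion ⇒ the zeros of `G` are real**: the degree-`d`, shift-`0` Jensen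
polynomials, rescaled, converge to `8 G` locally uniformly (Craven–Csordas 1989, Lemma 2.2), they
are zero-free off `ℝ` by hypothesis, and Hurwitz's theorem applies
(`Literature.Analysis.Complex.PolyaSchur.im_eq_zero_of_forall_splits_jensenPoly`). [cite: CravenCsordas1989, Lemma 2.2] -/
theorem im_eq_zero_of_xiSq_eq_zero_of_jensenPolyaCriterion (h : JensenPolyaCriterion) {z : ℂ}
    (hz : xiSq z = 0) : z.im = 0 :=
  im_eq_zero_of_forall_splits_jensenPoly summable_abs_xiTaylorCoeff_div_factorial_mul_pow
    hasSum_xiTaylorCoeff_div_factorial_mul_pow (differentiable_xiSq.const_mul 8)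
    (by simpa using xiSq_zero_ne) (fun d => h d 0) (by simp [hz])

/-- **The Jensen–Pólya criterion ⇒ RH** (the "hard" half of Pólya 1927): the zeros of `G` are real
by `im_eq_zero_of_xiSq_eq_zero_of_jensenPolyaCriterion`, hence RH by
`riemannHypothesis_of_forall_xiSq_eq_zero_im_eq_zero`. Only the shift `n = 0` of the criterion is
used. [cite: GORZPNAS2019, §1] -/
theorem riemannHypothesis_of_jensenPolyaCriterion (h : JensenPolyaCriterion) :
    RiemannHypothesis :=
  riemannHypothesis_of_forall_xiSq_eq_zero_im_eq_zero fun _ hz =>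
    im_eq_zero_of_xiSq_eq_zero_of_jensenPolyaCriterion h hz

/-- DISCHARGE of the named fact `Literature.NumberTheory.LFunctions.polya_jensen` (**Pólya 1927**, as stated in
Griffin–Ono–Rolen–Zagier, PNAS 116 (2019), §1: "RH is equivalent to the hyperbolicity of the
polynomials `J^{d,n}_γ(X)` for all nonnegative integers `d` and `n`"):
`RiemannHypothesis ↔ JensenPolyaCriterion`. [cite: Polya1927, via GORZPNAS2019 §1] -/
theorem polya_jensen_holds : polya_jensen :=
  ⟨jensenPolyaCriterion_of_riemannHypothesis, riemannHypothesis_of_jensenPolyaCriterion⟩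

end Literature.NumberTheory.LFunctions
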